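import Literature.Computability.MetaComplexity.BinaryPigeonholeResLinRank
import Literature.Computability.MetaComplexity.ResolutionProofs
import Literature.Computability.MetaComplexity.ResLinProofs
import HarnessLib

/-!
# The binary pigeonhole principle is unsatisfiable for `m > 2^ℓ` (non-vacuity of the rank bound)

Companion of `BinaryPigeonholeResLinRank.lean`: `bphpCNF m ℓ` (Efremenko–Garlík–Itsykson 2024,
§2.5) is unsatisfiable as soon as there are more pigeons than holes, `m > 2^ℓ` ("If `m > n`, then the
formula `BPHPᵐₙ` is unsatisfiable"), hence — by the completeness of resolution and the simulation of
resolution by Res(⊕), both proved in the tree — it HAS Res(⊕) refutations, so the rank bound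
`lt_resLinWidth_bphp` speaks about a nonempty set of refutations.

* `holeOf_injOn_of_eval_bphpCNF` — a satisfying assignment places the pigeons injectively;
* `bphpCNF_not_satisfiable` — unsatisfiable for `2^ℓ < m`;
* `exists_isResLinRefutation_bphpCNF` — a Res(⊕) refutation exists (`2^ℓ < m`);
* `exists_isResLinRefutation_and_lt_resLinWidth_bphp` — non-vacuous form of EGI24 Thm 5.5.

## References

* K. Efremenko, M. Garlík, D. Itsykson, STOC 2024, §2.5 [EfremenkoGarlikItsykson2024].
-/

namespace Literature.Computability.MetaComplexity

open _root_.Computability Complexity Finset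

/-- The clause of the pigeons `x < y < m` and the hole `S` belongs to `BPHPᵐ_{2^ℓ}`. [Efremenko–Garlík–
Itsykson 2024, §2.5] [cite: EfremenkoGarlikItsykson2024, §2.5] -/
theorem bphpClause_mem_bphpCNF {m ℓ x y : ℕ} (hxy : x < y) (hy : y < m) {S : List (Fin ℓ)}
    (hS : S ∈ (List.finRange ℓ).sublists) :
    bphpBlockClause ℓ x S ++ bphpBlockClause ℓ y S ∈ bphpCNF m ℓ := by
  unfold bphpCNF
  simp only [List.mem_flatMap, List.mem_finRange, true_and]
  refine ⟨⟨y, hy⟩, ⟨x, hxy.trans hy⟩, ?_⟩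
  rw [if_pos (by exact hxy)]
  exact List.mem_map.2 ⟨S, hS, rfl⟩

/-- **A satisfying assignment of `BPHP` places the pigeons injectively.** [Efremenko–Garlík–Itsykson
2024, §2.5 ("there are `m` pairwise different `ℓ`-bit binary strings")] [cite: EfremenkoGarlikItsykson2024, §2.5] -/
theorem holeOf_injOn_of_eval_bphpCNF {m ℓ : ℕ} {σ : ℕ → Bool} (hσ : (bphpCNF m ℓ).eval σ = true) :
    Set.InjOn (holeOf ℓ σ) {x | x < m} := by
  classical
  -- the clause of `x < y` and the hole of `x` is satisfied only through a bit of `y`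
  have key : ∀ x y : ℕ, x < y → y < m → holeOf ℓ σ x ≠ holeOf ℓ σ y := by
    intro x y hxy hy heq
    let S : List (Fin ℓ) := (List.finRange ℓ).filter fun j => σ (x * ℓ + j)
    have hS : S ∈ (List.finRange ℓ).sublists := List.mem_sublists.2 List.filter_sublist
    have hc := (CNF.eval_eq_true_iff _ _).1 hσ _ (bphpClause_mem_bphpCNF hxy hy hS)
    unfold Clause.eval at hc
    rw [List.any_eq_true] at hc
    obtain ⟨l, hl, hlev⟩ := hc
    have hmemS : ∀ j : Fin ℓ, j ∈ S ↔ σ (x * ℓ + j) = true := fun j => by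
      simp [S, List.mem_filter, List.mem_finRange]
    rcases List.mem_append.1 hl with hl | hl
    · obtain ⟨j, -, rfl⟩ := List.mem_map.1 hl
      simp only [Literal.eval, beq_iff_eq] at hlev
      have := hmemS j
      revert hlev this
      cases σ (x * ℓ + j) <;> by_cases hj : j ∈ S <;> simp [hj]
    · obtain ⟨j, -, rfl⟩ := List.mem_map.1 hl
      simp only [Literal.eval, beq_iff_eq] at hlev
      have h1 := hmemS j
      have h2 : σ (x * ℓ + j) = σ (y * ℓ + j) := congrFun heq j
      rw [h2] at h1
      revert hlev h1
      cases σ (y * ℓ + j) <;> by_cases hj : j ∈ S <;> simp [hj]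
  intro x hx y hy heq
  rcases Nat.lt_trichotomy x y with h | h | h
  · exact absurd heq (key x y h hy)
  · exact h
  · exact absurd heq.symm (key y x h hx)

/-- **`BPHPᵐ_{2^ℓ}` is unsatisfiable for `m > 2^ℓ`.** [Efremenko–Garlík–Itsykson 2024, §2.5 ("If
`m > n`, then the formula `BPHPᵐₙ` is unsatisfiable")] [cite: EfremenkoGarlikItsykson2024, §2.5] -/
theorem bphpCNF_not_satisfiable {m ℓ : ℕ} (h : 2 ^ ℓ < m) : ¬ (bphpCNF m ℓ).Satisfiable := by
  rintro ⟨σ, hσ⟩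
  have hinj : Function.Injective fun x : Fin m => holeOf ℓ σ x := by
    intro x y hxy
    exact Fin.ext (holeOf_injOn_of_eval_bphpCNF hσ x.isLt y.isLt hxy)
  have hcard := Fintype.card_le_of_injective _ hinj
  rw [Fintype.card_fin, Fintype.card_fun, Fintype.card_fin, Fintype.card_bool] at hcard
  omega

/-- Hence `BPHPᵐ_{2^ℓ}` (`m > 2^ℓ`) has Res(⊕) refutations (completeness of resolution,
`exists_isResRefutation_of_not_satisfiable_holds`, and the simulation
`IsResRefutation.exists_isResLinRefutation`). [Itsykson–Sokolov 2020, §2] [cite: ItsyksonSokolov2020, §2] -/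
theorem exists_isResLinRefutation_bphpCNF {m ℓ : ℕ} (h : 2 ^ ℓ < m) :
    ∃ π : List ResLinLine, IsResLinRefutation (bphpCNF m ℓ) π := by
  obtain ⟨π₀, hπ₀⟩ := exists_isResRefutation_of_not_satisfiable_holds (bphpCNF_not_satisfiable h)
  obtain ⟨π, hπ, -⟩ := hπ₀.exists_isResLinRefutation
  exact ⟨π, hπ⟩

/-- **Non-vacuous form of Efremenko–Garlík–Itsykson 2024, Thm 5.5**: for `ℓ ≥ 3` and `m > 2^ℓ` the
formula `BPHPᵐ_{2^ℓ}` has Res(⊕) refutations, and every one of them has a line of rank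
`> 2^(ℓ-2) = n/4`. [cite: EfremenkoGarlikItsykson2024, Theorem 5.5] -/
theorem exists_isResLinRefutation_and_lt_resLinWidth_bphp {m ℓ : ℕ} (hℓ : 3 ≤ ℓ) (h : 2 ^ ℓ < m) :
    (∃ π : List ResLinLine, IsResLinRefutation (bphpCNF m ℓ) π) ∧
      ∀ π : List ResLinLine, IsResLinRefutation (bphpCNF m ℓ) π → 2 ^ (ℓ - 2) < resLinWidth π :=
  ⟨exists_isResLinRefutation_bphpCNF h, fun _ hπ => lt_resLinWidth_bphp hℓ m hπ⟩

end Literature.Computability.MetaComplexity
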